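import Mathlib
import Literature.RingTheory.MvPolynomial.GrobnerDegeneration

/-!
# TropicalLinks / SchonResolves — the Gröbner degeneration of a homogeneous ideal is homogeneous

Route `ResolutionOfSingularities/TropicalLinks`, crux `SchonResolves` (stmt-ResolutionOfSingularities-17234),
line `zariski-toric-closure`, stub F2a.  For an ideal `I ⊆ k[x_σ]` which is homogeneous for the
standard grading and natural weights `W i : σ → ℕ` (`i : ι`), the ideal
`grobnerDegeneration W I ⊆ k[t_ι][x_σ]` of the Gröbner degeneration (the `∏ tᵢ`-saturation of the
ideal generated by the twists `t^{μ(f)} f(t^{-W} x)`, `f ∈ I`, of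
`Literature/RingTheory/MvPolynomial/GrobnerDegeneration`) is again homogeneous for the standard
`x`-grading over the base ring `k[t_ι]` (the `t`-variables sit in the coefficients, in degree `0`).

* `schonResolves_homogeneousComponent_twist` — the degree-`d` part of the twist of `f` is the
  twist of the degree-`d` part of `f`, up to the monomial factor `t^{μ(f) − μ(f_d)}`;
* `schonResolves_homogeneousComponent_mem_span_twist` — the ideal generated by the twists of a
  homogeneous ideal is homogeneous (it is generated by the homogeneous components of the twists,
  Mathlib's `Ideal.homogeneous_span`);
* `schonResolves_grobnerDegeneration_homogeneous` (F2a) — **the Gröbner degeneration of a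
  homogeneous ideal is homogeneous** (the saturating element `∏ tᵢ` has `x`-degree `0`).

Standard material (Eisenbud, *Commutative Algebra*, §15.8; Maclagan–Sturmfels, *Introduction to
Tropical Geometry*, §2.4–2.5), here as self-contained commutative algebra over any commutative
semiring of coefficients; no new definitions.
-/

-- single-problem summit: the doubled namespace component `ResolutionOfSingularities` is forced
set_option linter.dupNamespace false

namespace Summit.ResolutionOfSingularities.ResolutionOfSingularities.Theorems

open MvPolynomial Literature.RingTheory.MvPolynomial

section GrobnerHomogeneous

variable {R : Type*} [CommSemiring R] {σ ι : Type*}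

/-- The weighted total degree of a homogeneous component of `f` is at most that of `f`
(its support is smaller). [folklore] -/
theorem schonResolves_weightedTotalDegree_homogeneousComponent_le (w : σ → ℕ) (d : ℕ)
    (f : MvPolynomial σ R) :
    weightedTotalDegree w (homogeneousComponent d f) ≤ weightedTotalDegree w f := by
  apply Finset.sup_mono
  rw [support_homogeneousComponent]
  exact Finset.filter_subset _ _

/-- The degree-`d` component (for the `x`-grading) of `g · c^M`, `c` a constant of the base ring,
is `g_d · c^M`. [folklore] -/
theorem schonResolves_homogeneousComponent_mul_C_pow (g : MvPolynomial σ R) (r : R) (M d : ℕ) :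
    homogeneousComponent d (g * C r ^ M) = homogeneousComponent d g * C r ^ M := by
  rw [← map_pow, mul_comm, homogeneousComponent_C_mul, mul_comm]

variable [Finite ι] (W : ι → σ → ℕ)

/-- **The homogeneous components of a twist**: for the standard `x`-grading over `R[t_ι]`,
`(twist W f)_d = t^{μ(f) − μ(f_d)} · twist W (f_d)` where `f_d` is the degree-`d` component of
`f` and `μ(g)_i` the `W i`-weighted total degree of `g` (so `μ(f_d) ≤ μ(f)`). [folklore] -/
theorem schonResolves_homogeneousComponent_twist (d : ℕ) (f : MvPolynomial σ R) :
    homogeneousComponent d (twist W f) =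
      C (monomial (Finsupp.equivFunOnFinite.symm fun i =>
          weightedTotalDegree (W i) f - weightedTotalDegree (W i) (homogeneousComponent d f)) 1) *
        twist W (homogeneousComponent d f) := by
  classical
  ext1 a
  rw [coeff_homogeneousComponent, coeff_C_mul, coeff_twist, coeff_twist,
    coeff_homogeneousComponent]
  split_ifs with ha
  · by_cases hc : coeff a f = 0
    · rw [hc, monomial_zero, monomial_zero, mul_zero]
    · rw [monomial_mul, one_mul]
      refine congrArg (fun e => monomial e (coeff a f)) (Finsupp.ext fun i => ?_)
      have h1 : Finsupp.weight (W i) a ≤ weightedTotalDegree (W i) (homogeneousComponent d f) := by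
        apply le_weightedTotalDegree
        rw [mem_support_iff, coeff_homogeneousComponent, if_pos ha]
        exact hc
      have h2 := schonResolves_weightedTotalDegree_homogeneousComponent_le (R := R) (W i) d f
      simp only [Finsupp.coe_add, Pi.add_apply, twistExponent_apply,
        Finsupp.coe_equivFunOnFinite_symm]
      omega
  · rw [monomial_zero, mul_zero]

/-- For a homogeneous ideal `I`, every homogeneous component of the twist of a member of `I`
lies in the ideal generated by the twists of the members of `I`. [folklore] -/
theorem schonResolves_homogeneousComponent_twist_mem_span {I : Ideal (MvPolynomial σ R)}
    (hI : ∀ f ∈ I, ∀ d : ℕ, homogeneousComponent d f ∈ I) {f : MvPolynomial σ R} (hf : f ∈ I)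
    (d : ℕ) :
    homogeneousComponent d (twist W f) ∈
      Ideal.span (twist W '' (I : Set (MvPolynomial σ R))) := by
  rw [schonResolves_homogeneousComponent_twist]
  exact Ideal.mul_mem_left _ _ (Ideal.subset_span ⟨_, hI f hf d, rfl⟩)

/-- **The ideal generated by the twists of a homogeneous ideal is homogeneous** for the standard
`x`-grading over `R[t_ι]`: it is generated by the (homogeneous) components of the twists.
[folklore] -/
theorem schonResolves_homogeneousComponent_mem_span_twist {I : Ideal (MvPolynomial σ R)}
    (hI : ∀ f ∈ I, ∀ d : ℕ, homogeneousComponent d f ∈ I)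
    {g : MvPolynomial σ (MvPolynomial ι R)}
    (hg : g ∈ Ideal.span (twist W '' (I : Set (MvPolynomial σ R)))) (d : ℕ) :
    homogeneousComponent d g ∈ Ideal.span (twist W '' (I : Set (MvPolynomial σ R))) := by
  classical
  letI := MvPolynomial.gradedAlgebra (σ := σ) (R := MvPolynomial ι R)
  obtain ⟨T, hT⟩ : ∃ T : Set (MvPolynomial σ (MvPolynomial ι R)),
      T = {r | ∃ f ∈ I, ∃ e : ℕ, homogeneousComponent e (twist W f) = r} := ⟨_, rfl⟩
  have hle : Ideal.span (twist W '' (I : Set (MvPolynomial σ R))) ≤ Ideal.span T := by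
    refine Ideal.span_le.2 ?_
    rintro _ ⟨f, hf, rfl⟩
    rw [SetLike.mem_coe, ← sum_homogeneousComponent (twist W f)]
    exact Ideal.sum_mem _ fun e _ => Ideal.subset_span (hT ▸ ⟨f, hf, e, rfl⟩)
  have hge : Ideal.span T ≤ Ideal.span (twist W '' (I : Set (MvPolynomial σ R))) := by
    refine Ideal.span_le.2 ?_
    intro r hr
    rw [hT] at hr
    obtain ⟨f, hf, e, rfl⟩ := hr
    exact schonResolves_homogeneousComponent_twist_mem_span W hI hf e
  have heq : Ideal.span (twist W '' (I : Set (MvPolynomial σ R))) = Ideal.span T :=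
    le_antisymm hle hge
  have hhom : (Ideal.span T).IsHomogeneous (homogeneousSubmodule σ (MvPolynomial ι R)) := by
    refine Ideal.homogeneous_span _ _ fun r hr => ?_
    rw [hT] at hr
    obtain ⟨f, -, e, rfl⟩ := hr
    exact ⟨e, homogeneousComponent_mem e _⟩
  rw [heq] at hg ⊢
  exact homogeneousComponent_mem_of_mem hhom hg d

end GrobnerHomogeneous

/-- **F2a — the Gröbner degeneration of a homogeneous ideal is homogeneous.**  For a field `k`,
natural weights `W i : σ → ℕ` and an ideal `I ⊆ k[x_σ]` stable under taking homogeneous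
components (standard grading), the degeneration ideal `grobnerDegeneration W I ⊆ k[t_ι][x_σ]`
(the `∏ tᵢ`-saturation of the ideal of twists) is stable under taking homogeneous components for
the `x`-grading over `k[t_ι]`. [folklore] -/
theorem schonResolves_grobnerDegeneration_homogeneous : ∀ (k : Type) [Field k] (σ ι : Type) [Fintype ι] [DecidableEq ι] (W : ι → σ → ℕ) (I : Ideal (MvPolynomial σ k)), (∀ f ∈ I, ∀ d : ℕ, MvPolynomial.homogeneousComponent d f ∈ I) → ∀ g ∈ Literature.RingTheory.MvPolynomial.grobnerDegeneration W I, ∀ d : ℕ, MvPolynomial.homogeneousComponent d g ∈ Literature.RingTheory.MvPolynomial.grobnerDegeneration W I := by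
  intro k _ σ ι _ _ W I hI g hg d
  obtain ⟨M, hM⟩ := hg
  refine ⟨M, ?_⟩
  rw [← schonResolves_homogeneousComponent_mul_C_pow]
  exact schonResolves_homogeneousComponent_mem_span_twist W hI hM d

end Summit.ResolutionOfSingularities.ResolutionOfSingularities.Theorems
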